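import Literature.Geometry.Lorentzian.WeightedNorms
import HarnessLib

/-!
# The dilation law of the weighted Sobolev seminorms on `E3` (Mao–Oh–Tao's scaled annular norms)

Mao–Oh–Tao, *Initial data gluing in the asymptotically flat regime via solution operators with
prescribed support properties*, arXiv:2308.13031, Def. 1.5 and its footnote (held text, p. 6):
`‖u‖_{Ḣ^s(Ã_R)} := R^{−s+3/2} ‖u(R·)‖_{H^s(Ã_1)}` — the unit-scale Sobolev norm of the dilate measures a
field on the dyadic annulus `Ã_R`.  This file proves, hypothesis-free (ANY `f`, no smoothness, no
openness), the DILATION LAW of the tree's inhomogeneous `(1+r)`-weighted seminorm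
`weightedSobolevSeminorm` (`WeightedNorms`, Bartnik 1986 (1.2)–(1.3)) under `y ↦ t • y`, in the two-set
`MapsTo` form that serves both directions of that footnote (`t = R`: «scaled ≲ weighted», `t = R⁻¹`:
«weighted ≲ scaled»):

* `setLIntegral_comp_smul_E3` — change of variables `∫⁻_A F(t y) dy = t⁻³ ∫⁻_{t • A} F` on `E3`;
* `exists_smulEquiv`, `norm_iteratedFDeriv_smul_comp_smul_le` — `‖Dᵐ (z ↦ a • f (t • z))(y)‖ ≤ |a| tᵐ ‖(Dᵐ f)(t • y)‖`
  for ANY `f` (linear equivalences commute with `iteratedFDeriv` unconditionally);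
* `weightedSobolevSeminorm_dilate_le` — **the dilation law**: if the weights compare pointwise on `A`,
  `(1+‖y‖)^{2(δ₁+m)} (a tᵐ)² ≤ c² t³ (1+‖t y‖)^{2(δ₂+m)}` for `m ≤ s`, and `t • A ⊆ B`, then
  `‖a • f(t ·)‖_{H^s_{δ₁}(A)} ≤ c ‖f‖_{H^s_{δ₂}(B)}`;
* `scaledAnnulusSize R u v` — MOT's unit-scale annular size of a pair `(u, v)` (a metric perturbation and
  a second fundamental form, valued in bilinear forms on `E3`) at scale `R` and orders `(12, 10)`:
  `‖u(R·)‖_{H¹²(Ã₁)} + ‖R · v(R·)‖_{H¹⁰(Ã₁)}`, `Ã₁ = {1/2 < |x| < 4}` (the `R`-power of the footnote is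
  carried by the caller); `scaledAnnulusSize_le_adaptedLO` — «scaled ≲ weighted» at the matched orders
  against `H¹²_{γ−1/2} × H¹⁰_{γ+1/2}` on `{Rₑ < r}` under explicit pointwise `R`-power side conditions.

Provenance: decomp-fsc lens-2 g35 side file `DyadicComparison35.lean` (§T1–§T2, farm-checked there),
re-homed verbatim into the `Literature.Geometry.Lorentzian` namespace (tranche 1 of the cell's
«ScaledAF» typing ticket); docstrings completed with cites.  NOT here: the asymptotic-flatness
consequence («finite weighted size ⇒ MOT-scaled-AF», tranche 2) and the family-size limits (tranche 3).
-/

noncomputable section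

namespace Literature.Geometry.Lorentzian

open scoped ContDiff Topology ENNReal Pointwise
open Filter Set Function _root_.MeasureTheory Metric

section DyadicComparison

variable {G : Type*} [NormedAddCommGroup G] [NormedSpace ℝ G]

/-- Change of variables `y ↦ t • y` (`0 < t`) in a set integral on `E3`: `∫⁻_A F(t y) dy = t⁻³ ∫⁻_{t • A} F`
(for ANY `F`; `A` measurable): the change of variables behind the scaling footnote of Mao–Oh–Tao, Def. 1.5. [cite: MaoOhTao2023, Def. 1.5 (footnote, arXiv p. 6)] -/
theorem setLIntegral_comp_smul_E3 (F : E3 → ℝ≥0∞) {t : ℝ} (ht : 0 < t) {A : Set E3} (hA : MeasurableSet A) :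
    ∫⁻ y in A, F (t • y) = ENNReal.ofReal ((t ^ 3)⁻¹) * ∫⁻ x in t • A, F x := by
  have ht0 : t ≠ 0 := ht.ne'
  let e : E3 ≃ᵐ E3 := (Homeomorph.smul (Units.mk0 t ht0)).toMeasurableEquiv
  have he : ∀ y : E3, e y = t • y := fun _ ↦ rfl
  have hsm : MeasurableSet (t • A) := hA.const_smul_of_ne_zero ht0
  have hind : ∀ y : E3, A.indicator (fun z ↦ F (t • z)) y = (t • A).indicator F (t • y) := by
    intro y
    by_cases hy : y ∈ A
    · rw [indicator_of_mem hy, indicator_of_mem (smul_mem_smul_set hy)]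
    · rw [indicator_of_notMem hy, indicator_of_notMem]
      rwa [Set.smul_mem_smul_set_iff₀ ht0]
  calc ∫⁻ y in A, F (t • y) = ∫⁻ y, A.indicator (fun z ↦ F (t • z)) y := (lintegral_indicator hA _).symm
    _ = ∫⁻ y, (t • A).indicator F (e y) := lintegral_congr fun y ↦ by rw [hind, he]
    _ = ∫⁻ x, (t • A).indicator F x ∂(Measure.map e volume) := (lintegral_map_equiv _ e).symm
    _ = ∫⁻ x, (t • A).indicator F x ∂(ENNReal.ofReal |(t ^ Module.finrank ℝ E3)⁻¹| • volume) := by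
        have hmap : Measure.map (e : E3 → E3) volume = Measure.map (fun y : E3 ↦ t • y) volume := by
          congr 1
        rw [hmap, Measure.map_addHaar_smul volume ht0]
    _ = ENNReal.ofReal ((t ^ 3)⁻¹) * ∫⁻ x in t • A, F x := by
        rw [lintegral_smul_measure, lintegral_indicator hsm, finrank_euclideanSpace_fin,
          abs_of_nonneg (inv_nonneg.2 (pow_nonneg ht.le 3)), smul_eq_mul]

/-- Multiplication by a scalar `c ≠ 0` as a continuous linear EQUIVALENCE, of operator norm `≤ |c|`. [folklore] -/
private theorem exists_smulEquiv {V : Type*} [NormedAddCommGroup V] [NormedSpace ℝ V] {c : ℝ} (hc : c ≠ 0) :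
    ∃ L : V ≃L[ℝ] V, (∀ v, L v = c • v) ∧ ‖(L : V →L[ℝ] V)‖ ≤ |c| :=
  ⟨ContinuousLinearEquiv.equivOfInverse (c • ContinuousLinearMap.id ℝ V) (c⁻¹ • ContinuousLinearMap.id ℝ V)
      (fun v ↦ by simp [smul_smul, mul_inv_cancel₀ hc]) (fun v ↦ by simp [smul_smul, inv_mul_cancel₀ hc]),
    fun _ ↦ rfl, by
      change ‖c • ContinuousLinearMap.id ℝ V‖ ≤ |c|
      rw [norm_smul, Real.norm_eq_abs]
      exact mul_le_of_le_one_right (abs_nonneg c) ContinuousLinearMap.norm_id_le⟩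

/-- Chain rule for the dilation as a NORM BOUND, for ANY `f` (junk values included — `z ↦ t • z` and, for `a ≠ 0`,
`w ↦ a • w` are linear equivalences, which commute with `iteratedFDeriv` unconditionally; `a = 0` is trivial):
`‖Dᵐ (z ↦ a • f (t • z)) (y)‖ ≤ |a| tᵐ ‖(Dᵐ f)(t • y)‖` — the derivative count of the scaling footnote of
Mao–Oh–Tao, Def. 1.5. [cite: MaoOhTao2023, Def. 1.5 (footnote, arXiv p. 6)] -/
theorem norm_iteratedFDeriv_smul_comp_smul_le (f : E3 → G) (a : ℝ) {t : ℝ} (ht : 0 < t) (m : ℕ) (y : E3) :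
    ‖iteratedFDeriv ℝ m (fun z : E3 ↦ a • f (t • z)) y‖ ≤
      |a| * t ^ m * ‖iteratedFDeriv ℝ m f (t • y)‖ := by
  rcases eq_or_ne a 0 with rfl | ha
  · simp
  obtain ⟨L, hL, hLn⟩ := exists_smulEquiv (V := E3) ht.ne'
  obtain ⟨M, hM, hMn⟩ := exists_smulEquiv (V := G) ha
  have hfun : (fun z : E3 ↦ a • f (t • z)) = M ∘ (f ∘ L) :=
    funext fun z ↦ by rw [comp_apply, comp_apply, hL, hM]
  have hcomp := L.iteratedFDerivWithin_comp_right f uniqueDiffOn_univ (x := y) (mem_univ _) m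
  rw [preimage_univ, iteratedFDerivWithin_univ, iteratedFDerivWithin_univ] at hcomp
  rw [hfun, M.iteratedFDeriv_comp_left, hcomp, hL, mul_assoc]
  refine (ContinuousLinearMap.norm_compContinuousMultilinearMap_le _ _).trans
    (mul_le_mul hMn ?_ (norm_nonneg _) (abs_nonneg a))
  refine (ContinuousMultilinearMap.norm_compContinuousLinearMap_le _ _).trans ?_
  rw [Finset.prod_const, Finset.card_univ, Fintype.card_fin, mul_comm]
  exact mul_le_mul_of_nonneg_right (pow_le_pow_left₀ (norm_nonneg _) (hLn.trans (abs_of_pos ht).le) m)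
    (norm_nonneg _)

/-- **The DILATION LAW of `weightedSobolevSeminorm`** (PROVED, hypothesis-free: ANY `f`, no smoothness,
no openness).  `A` measurable, `0 < t`, `t • A ⊆ B` (as a `MapsTo`),
amplitude `a`.  If the weights compare pointwise on `A` in the norm's own (squared) form — for `m ≤ s`,
`(1+‖y‖)^{2(δ₁+m)} (a tᵐ)² ≤ c² t³ (1+‖t y‖)^{2(δ₂+m)}` — then
`‖a • f(t ·)‖_{H^s_{δ₁}(A)} ≤ c ‖f‖_{H^s_{δ₂}(B)}`.  Proof: `norm_iteratedFDeriv_smul_comp_smul_le`, change of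
variables `dy = t⁻³ dx`, monotonicity of `∫⁻` and of `x ↦ x^{1/2}`.  This is MOT arXiv:2308.13031 Def 1.5's
footnote (`‖u‖_{Ḣˢ(Ã_R)} := R^{3/2−s} ‖u(R·)‖_{Hˢ(Ã₁)}`) in the tree's inhomogeneous `(1+r)`-weighted
currency: `t = R` serves «scaled ≲ LO», `t = R⁻¹` serves «LO ≲ scaled»; the `R`-power bookkeeping is the
caller's pointwise inequality `hw`. [cite: MaoOhTao2023, Def. 1.5 (footnote, arXiv p. 6)] -/
theorem weightedSobolevSeminorm_dilate_le {A B : Set E3} (hA : MeasurableSet A) {t : ℝ} (ht : 0 < t)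
    (hAB : MapsTo (fun y : E3 ↦ t • y) A B) (f : E3 → G) (a : ℝ) {s : ℕ} {δ₁ δ₂ c : ℝ} (hc : 0 ≤ c)
    (hw : ∀ m : ℕ, m ≤ s → ∀ y ∈ A, (1 + ‖y‖) ^ (2 * (δ₁ + m) : ℝ) * (a * t ^ m) ^ 2 ≤
      c ^ 2 * t ^ 3 * (1 + ‖t • y‖) ^ (2 * (δ₂ + m) : ℝ)) :
    weightedSobolevSeminorm A s δ₁ (fun y : E3 ↦ a • f (t • y)) ≤
      ENNReal.ofReal c * weightedSobolevSeminorm B s δ₂ f := by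
  have ht0 : t ≠ 0 := ht.ne'
  have hsub : t • A ⊆ B := by
    rintro _ ⟨y, hy, rfl⟩
    exact hAB hy
  -- order-`m` weighted size functions of `f` on `B` and of `a • f (t ·)` on `A`
  set Φ : ℕ → E3 → ℝ≥0∞ := fun m x ↦
    ENNReal.ofReal ((1 + ‖x‖) ^ (2 * (δ₂ + m) : ℝ) * ‖iteratedFDeriv ℝ m f x‖ ^ 2) with hΦ
  set Ψ : ℕ → E3 → ℝ≥0∞ := fun m y ↦
    ENNReal.ofReal ((1 + ‖y‖) ^ (2 * (δ₁ + m) : ℝ) * ‖iteratedFDeriv ℝ m (fun z : E3 ↦ a • f (t • z)) y‖ ^ 2) with hΨ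
  have hterm : ∀ m ∈ Finset.range (s + 1), ∫⁻ y in A, Ψ m y ≤ ENNReal.ofReal (c ^ 2) * ∫⁻ x in B, Φ m x := by
    intro m hm
    have hm' : m ≤ s := Nat.lt_succ_iff.mp (Finset.mem_range.mp hm)
    calc ∫⁻ y in A, Ψ m y ≤ ∫⁻ y in A, ENNReal.ofReal (c ^ 2 * t ^ 3) * Φ m (t • y) := by
          refine setLIntegral_mono' hA fun y hy ↦ ?_
          rw [hΨ, hΦ, ← ENNReal.ofReal_mul (by positivity)]
          refine ENNReal.ofReal_le_ofReal ?_
          have hD := norm_iteratedFDeriv_smul_comp_smul_le f a ht m y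
          calc (1 + ‖y‖) ^ (2 * (δ₁ + m) : ℝ) * ‖iteratedFDeriv ℝ m (fun z : E3 ↦ a • f (t • z)) y‖ ^ 2
              ≤ (1 + ‖y‖) ^ (2 * (δ₁ + m) : ℝ) * (|a| * t ^ m * ‖iteratedFDeriv ℝ m f (t • y)‖) ^ 2 := by
                gcongr
            _ = ((1 + ‖y‖) ^ (2 * (δ₁ + m) : ℝ) * (a * t ^ m) ^ 2) * ‖iteratedFDeriv ℝ m f (t • y)‖ ^ 2 := by
                rw [mul_pow, mul_pow, mul_pow, sq_abs]; ring
            _ ≤ (c ^ 2 * t ^ 3 * (1 + ‖t • y‖) ^ (2 * (δ₂ + m) : ℝ)) * ‖iteratedFDeriv ℝ m f (t • y)‖ ^ 2 :=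
                mul_le_mul_of_nonneg_right (hw m hm' y hy) (sq_nonneg _)
            _ = c ^ 2 * t ^ 3 * ((1 + ‖t • y‖) ^ (2 * (δ₂ + m) : ℝ) * ‖iteratedFDeriv ℝ m f (t • y)‖ ^ 2) := by
                ring
      _ = ENNReal.ofReal (c ^ 2 * t ^ 3) * ∫⁻ y in A, Φ m (t • y) :=
          lintegral_const_mul' _ _ ENNReal.ofReal_ne_top
      _ ≤ ENNReal.ofReal (c ^ 2 * t ^ 3) * (ENNReal.ofReal ((t ^ 3)⁻¹) * ∫⁻ x in B, Φ m x) := by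
          refine mul_le_mul_right ?_ _
          rw [setLIntegral_comp_smul_E3 (Φ m) ht hA]
          exact mul_le_mul_right (lintegral_mono_set hsub) _
      _ = ENNReal.ofReal (c ^ 2) * ∫⁻ x in B, Φ m x := by
          rw [← mul_assoc, ← ENNReal.ofReal_mul (by positivity), mul_inv_cancel_right₀ (pow_ne_zero 3 ht0)]
  have hsum : ∑ m ∈ Finset.range (s + 1), ∫⁻ y in A, Ψ m y ≤
      ENNReal.ofReal (c ^ 2) * ∑ m ∈ Finset.range (s + 1), ∫⁻ x in B, Φ m x := by
    rw [Finset.mul_sum]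
    exact Finset.sum_le_sum hterm
  have hc2 : ENNReal.ofReal (c ^ 2) ^ (1 / 2 : ℝ) = ENNReal.ofReal c := by
    rw [ENNReal.ofReal_rpow_of_nonneg (sq_nonneg c) (by norm_num), ← Real.sqrt_eq_rpow, Real.sqrt_sq hc]
  unfold weightedSobolevSeminorm
  calc (∑ m ∈ Finset.range (s + 1), ∫⁻ y in A, Ψ m y) ^ (1 / 2 : ℝ)
      ≤ (ENNReal.ofReal (c ^ 2) * ∑ m ∈ Finset.range (s + 1), ∫⁻ x in B, Φ m x) ^ (1 / 2 : ℝ) :=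
        ENNReal.rpow_le_rpow hsum (by norm_num)
    _ = ENNReal.ofReal c * (∑ m ∈ Finset.range (s + 1), ∫⁻ x in B, Φ m x) ^ (1 / 2 : ℝ) := by
        rw [ENNReal.mul_rpow_of_nonneg _ _ (by norm_num), hc2]

/-- **Mao–Oh–Tao's unit-scale annular size** of a pair `(u, v)` of bilinear-form-valued fields on `E3` (a metric
perturbation `u = g − δ` and a second fundamental form `v = k`) at scale `R`, at the orders `(12, 10)`:
`‖u(R·)‖_{H¹²(Ã₁)} + ‖R · v(R·)‖_{H¹⁰(Ã₁)}` on the unit annulus `Ã₁ = {1/2 < |x| < 4}` (unweighted, `δ = 0`), i.e.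
the footnote norm `‖·‖_{Ḣ^s(Ã_R)}` of Def. 1.5 WITHOUT its prefactor `R^{−s+3/2}` (carried by callers) and with the
one extra power of `R` on `k` that makes `(g, k)` scale alike. [cite: MaoOhTao2023, Def. 1.5 (footnote, arXiv p. 6)] -/
def scaledAnnulusSize (R : ℝ) (u v : E3 → (E3 →L[ℝ] E3 →L[ℝ] ℝ)) : ℝ≥0∞ :=
  weightedSobolevSeminorm {x : E3 | 1 / 2 < ‖x‖ ∧ ‖x‖ < 4} 12 0 (fun x ↦ u (R • x)) +
    weightedSobolevSeminorm {x : E3 | 1 / 2 < ‖x‖ ∧ ‖x‖ < 4} 10 0 (fun x ↦ R • v (R • x))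

/-- **«scaled ≲ weighted» at the matched orders (12, 10)**: for `0 < R`, `2 Rₑ ≤ R`
(so `R • Ã₁ ⊆ {Rₑ < r}`) and ANY `u, v`, MOT's unit-scale size of `(u, v)` at scale `R` is at most
`c_h ‖u‖_{H¹²_{γ−1/2}({Rₑ < r})} + c_k ‖v‖_{H¹⁰_{γ+1/2}({Rₑ < r})}` — i.e. against the two summands of
the weighted graft size at `N = 11` (`N + 1 = 12`, `N − 1 = 10`; `Rₑ` the end radius) — for ANY constants `c_h, c_k ≥ 0` satisfying the
two pointwise `R`-power side conditions on `Ã₁` (desk values `K(γ) R^{−1−γ}`: `m = 0` via `(1 + 4R)^{2γ−1} ≥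
(5R)^{2γ−1}` for `R ≥ 1`, `m ≥ 1` via `1 + R‖y‖ > R/2`; their discharge is the caller's). [cite: MaoOhTao2023, Def. 1.5 (footnote, arXiv p. 6)] -/
theorem scaledAnnulusSize_le_adaptedLO {Rₑ R γ ch ck : ℝ} (hR : 0 < R) (hRe : 2 * Rₑ ≤ R)
    (u v : E3 → (E3 →L[ℝ] E3 →L[ℝ] ℝ)) (hch : 0 ≤ ch) (hck : 0 ≤ ck)
    (hwh : ∀ m : ℕ, m ≤ 12 → ∀ y ∈ {x : E3 | 1 / 2 < ‖x‖ ∧ ‖x‖ < 4},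
      (1 + ‖y‖) ^ (2 * m : ℝ) * (R ^ m) ^ 2 ≤ ch ^ 2 * R ^ 3 * (1 + ‖R • y‖) ^ (2 * (γ - 1 / 2 + m) : ℝ))
    (hwk : ∀ m : ℕ, m ≤ 10 → ∀ y ∈ {x : E3 | 1 / 2 < ‖x‖ ∧ ‖x‖ < 4},
      (1 + ‖y‖) ^ (2 * m : ℝ) * (R * R ^ m) ^ 2 ≤ ck ^ 2 * R ^ 3 * (1 + ‖R • y‖) ^ (2 * (γ + 1 / 2 + m) : ℝ)) :
    scaledAnnulusSize R u v ≤
      ENNReal.ofReal ch * weightedSobolevSeminorm {x : E3 | Rₑ < ‖x‖} 12 (γ - 1 / 2) u +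
        ENNReal.ofReal ck * weightedSobolevSeminorm {x : E3 | Rₑ < ‖x‖} 10 (γ + 1 / 2) v := by
  have hA : MeasurableSet {x : E3 | 1 / 2 < ‖x‖ ∧ ‖x‖ < 4} :=
    measurableSet_Ioo.preimage continuous_norm.measurable
  have hAB : MapsTo (fun y : E3 ↦ R • y) {x : E3 | 1 / 2 < ‖x‖ ∧ ‖x‖ < 4} {x : E3 | Rₑ < ‖x‖} := by
    intro y hy
    show Rₑ < ‖R • y‖
    rw [norm_smul, Real.norm_of_nonneg hR.le]
    nlinarith [hy.1]
  unfold scaledAnnulusSize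
  refine add_le_add ?_ (weightedSobolevSeminorm_dilate_le hA hR hAB v R hck fun m hm y hy ↦ by
    simpa only [zero_add] using hwk m hm y hy)
  rw [show (fun x : E3 ↦ u (R • x)) = fun x ↦ (1 : ℝ) • u (R • x) from funext fun _ ↦ (one_smul ℝ _).symm]
  exact weightedSobolevSeminorm_dilate_le hA hR hAB u 1 hch fun m hm y hy ↦ by
    simpa only [zero_add, one_mul] using hwh m hm y hy

end DyadicComparison

end Literature.Geometry.Lorentzian

end
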